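import Literature.NumberTheory.Transcendental.RoySmallValuePhi
import Literature.NumberTheory.Transcendental.RoySmallValueMatrixMult
import Literature.NumberTheory.Transcendental.RoySmallValueZeros
import HarnessLib

/-!
# Roy's small value estimate for `𝔾ₐ × 𝔾ₘ` — multiplicity of `Φ` along `(I_D^{(γ,T)})³` (Theorem 5.2 / Corollary 5.7, line form)

Topic `Literature/NumberTheory/Transcendental`. Part of the formalisation of the proof of Roy 2013,
Theorem 1.1 (named fact `roy2013_thm_1_1`, `RoySmallValueEstimates.lean`). Source: D. Roy,
*A small value estimate for `𝔾ₐ × 𝔾ₘ`*, Mathematika 59 (2013) 333–363 = arXiv:1301.0663, §5,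
Theorem 5.2 and Corollary 5.7 (pp. 13–15 of the arXiv text):

> **Corollary 5.7.** Let `γ ∈ 𝒢` and `D, T ∈ ℕ*` with `T ≤ binom(D+1, 2)`. Then the resultant in
> degree `D` vanishes up to order `T` at each triple `(P, Q, R)` of elements of `I_D^{(γ,T)}`.

We prove the corresponding statement for the determinant `Φ = royPhi` of the proof of
Theorem 5.2 (which is what that proof establishes first, and what Propositions 6.1 and 6.4
consume), restricted to lines as used there: **for `Q ∈ (I_D^{(γ,T)})³` and any direction `R`,
`t ↦ Φ(Q + tR)` is a polynomial divisible by `t^T`** (`royPhi_line_multiplicity`), as soon as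
`T ≤ binom(3D+2, 2)`. Ingredients: the `T` linear functionals `F ↦ 𝒟ᵏF(1, γ)` on `ℂ[X]_{3D}`
(`dMat`) are independent — they admit the right inverse given by Proposition 3.3
(`exists_isHomogeneous_iterate_homD_eq`) — and kill every column `X^μ Qᵢ ∈ I^{(γ,T)}` of `M_Q`
(Roy: "the first `deg(I)` rows of `M_Q` vanish because the image of `φ_Q` is contained in
`I_ν`", with `deg I^{(γ,T)} = T` replaced by the codimension `T` of `I_{3D}^{(γ,T)}` in
`ℂ[X]_{3D}`, Corollary 3.4 via Proposition 3.3); then `X_pow_card_dvd_det_line` applies.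

One definition (`dMat`); everything here is proved; no new named facts.

## References

* [Roy2013] D. Roy, *A small value estimate for 𝔾ₐ × 𝔾ₘ*, Mathematika 59 (2013), 333–363
  (arXiv:1301.0663), §5, Theorem 5.2, Corollary 5.7.
-/

noncomputable section

open MvPolynomial Finset Module Matrix

namespace Literature.NumberTheory.Transcendental

namespace Roy2013

variable {D : ℕ} {M₁ M₂ : Finset (Fin 3 →₀ ℕ)}

/-! ### Forms of degree `3D` as coefficient vectors -/

/-- A form of degree `3D` is the sum of its coefficients times the degree-`3D` monomials.
[folklore] -/
theorem sum_row_coeff_smul_monomial {F : CX} (hF : F.IsHomogeneous (3 * D)) :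
    ∑ e : ↥(finsuppAntidiag (univ : Finset (Fin 3)) (3 * D)), coeff e.1 F • monomial e.1 (1 : ℂ) = F := by
  classical
  have hsupp : ∀ ν ∈ F.support, ν ∈ finsuppAntidiag (univ : Finset (Fin 3)) (3 * D) := by
    intro ν hν
    rw [mem_finsuppAntidiag]
    refine ⟨?_, by simp⟩
    have h1 : ν.degree = 3 * D := by
      rw [Finsupp.degree_eq_weight_one]; exact hF (mem_support_iff.mp hν)
    rwa [Finsupp.degree_eq_sum] at h1
  conv_rhs => rw [F.as_sum]
  rw [Finset.sum_coe_sort (finsuppAntidiag (univ : Finset (Fin 3)) (3 * D))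
    (fun ν => coeff ν F • monomial ν (1 : ℂ))]
  rw [← Finset.sum_subset hsupp (fun ν _ hν => by
    rw [notMem_support_iff.mp hν, zero_smul])]
  exact Finset.sum_congr rfl fun ν _ => by rw [smul_monomial, smul_eq_mul, mul_one]

/-- `𝒟ᵏ(∑ cₑ X^e)(1, γ) = ∑ cₑ 𝒟ᵏ(X^e)(1, γ)`. [folklore] -/
theorem aeval_iterate_homD_sum_smul (ξ η : ℂ) (k : ℕ)
    (c : ↥(finsuppAntidiag (univ : Finset (Fin 3)) (3 * D)) → ℂ) :
    aeval ![1, ξ, η] (homD^[k] (∑ e, c e • monomial e.1 (1 : ℂ))) =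
      ∑ e, c e * aeval ![1, ξ, η] (homD^[k] (monomial e.1 (1 : ℂ))) := by
  rw [iterate_homD_sum, map_sum]
  exact Finset.sum_congr rfl fun e _ => by rw [iterate_homD_smul, map_smul, smul_eq_mul]

/-! ### The functionals `F ↦ 𝒟ᵏF(1, γ)` on `ℂ[X]_{3D}` -/

/-- The `T × binom(3D+2,2)` matrix of the functionals `F ↦ 𝒟ᵏF(1, ξ, η)` (`k < T`) in the
monomial coordinates of `ℂ[X]_{3D}`. [cite: Roy2013, §5, proof of Theorem 5.2] -/
def dMat (ξ η : ℂ) (D T : ℕ) :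
    Matrix (Fin T) ↥(finsuppAntidiag (univ : Finset (Fin 3)) (3 * D)) ℂ :=
  Matrix.of fun k e => aeval ![1, ξ, η] (homD^[k.1] (monomial e.1 (1 : ℂ)))

/-- **The functionals are independent**: `dMat` has a right inverse when `T ≤ binom(3D+2, 2)`
(Proposition 3.3 provides forms with prescribed `𝒟ʲF(1, γ)`, `j < binom(3D+2, 2)`).
[cite: Roy2013, §5, proof of Theorem 5.2; Corollary 3.4] -/
theorem exists_rightInverse_dMat {ξ η : ℂ} (hη : η ≠ 0) {T : ℕ} (hT : T ≤ (3 * D + 2).choose 2) :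
    ∃ N : Matrix ↥(finsuppAntidiag (univ : Finset (Fin 3)) (3 * D)) (Fin T) ℂ,
      dMat ξ η D T * N = 1 := by
  classical
  have hF : ∀ k : Fin T, ∃ F : CX, F.IsHomogeneous (3 * D) ∧
      ∀ j < (3 * D + 2).choose 2, aeval ![1, ξ, η] (homD^[j] F) = if j = k.1 then 1 else 0 :=
    fun k => exists_isHomogeneous_iterate_homD_eq (3 * D) hη (fun j => if j = k.1 then 1 else 0)
  choose F hFh hFv using hF
  refine ⟨Matrix.of fun e k => coeff e.1 (F k), ?_⟩
  ext k k'
  rw [Matrix.mul_apply, Matrix.one_apply]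
  calc ∑ e, dMat ξ η D T k e * (Matrix.of fun e k => coeff e.1 (F k)) e k'
      = ∑ e, coeff e.1 (F k') * aeval ![1, ξ, η] (homD^[k.1] (monomial e.1 (1 : ℂ))) :=
        Finset.sum_congr rfl fun e _ => by rw [dMat, Matrix.of_apply, Matrix.of_apply, mul_comm]
    _ = aeval ![1, ξ, η] (homD^[k.1] (F k')) := by
        rw [← aeval_iterate_homD_sum_smul, sum_row_coeff_smul_monomial (hFh k')]
    _ = if k = k' then 1 else 0 := by
        rw [hFv k' k.1 (lt_of_lt_of_le k.2 hT)]
        simp only [Fin.ext_iff]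

/-- **The functionals kill the columns of `M_Q` for `Q ∈ (I^{(γ,T)})³`**: `dMat · M_Q = 0`.
[cite: Roy2013, §5, proof of Theorem 5.2] -/
theorem dMat_mul_royMatrix {ξ η : ℂ} {T : ℕ} (hM₁ : ∀ μ ∈ M₁, μ.degree = 2 * D)
    (hM₂ : ∀ μ ∈ M₂, μ.degree = 2 * D) {Qs : Fin 3 → CX} (hQh : ∀ i, (Qs i).IsHomogeneous D)
    (hQv : ∀ i, Qs i ∈ vanIdeal ξ η T) :
    dMat ξ η D T * royMatrix D M₁ M₂ Qs = 0 := by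
  ext k c
  rw [Matrix.mul_apply, Matrix.zero_apply]
  -- the column is the coefficient vector of `X^μ Qᵢ ∈ I^{(γ,T)} ∩ ℂ[X]_{3D}`
  have hcol : (monomial (colExp c) (1 : ℂ) * Qs (colBlock c)).IsHomogeneous (3 * D) := by
    have h := isHomogeneous_combo (M₁ := M₁) (M₂ := M₂) hQh hM₁ hM₂ (Pi.single c 1)
    rwa [combo, Finset.sum_eq_single c (fun c' _ hc' => by rw [Pi.single_eq_of_ne hc', zero_smul])
      (fun h => absurd (Finset.mem_univ c) h), Pi.single_eq_same, one_smul] at h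
  calc ∑ e, dMat ξ η D T k e * royMatrix D M₁ M₂ Qs e c
      = ∑ e, coeff e.1 (monomial (colExp c) (1 : ℂ) * Qs (colBlock c)) *
          aeval ![1, ξ, η] (homD^[k.1] (monomial e.1 (1 : ℂ))) :=
        Finset.sum_congr rfl fun e _ => by rw [dMat, Matrix.of_apply, royMatrix_apply, mul_comm]
    _ = aeval ![1, ξ, η] (homD^[k.1] (monomial (colExp c) (1 : ℂ) * Qs (colBlock c))) := by
        rw [← aeval_iterate_homD_sum_smul, sum_row_coeff_smul_monomial hcol]
    _ = 0 := (Ideal.mul_mem_left _ _ (hQv (colBlock c))) k.1 k.2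

/-! ### Multiplicity along lines -/

/-- `M_{Q + tR}` reindexed is `A + t B`. [cite: Roy2013, §5, proof of Theorem 5.2] -/
theorem reindex_royMatrix_line
    (σ : (↥(finsuppAntidiag (univ : Finset (Fin 3)) (2 * D)) ⊕ (↥M₁ ⊕ ↥M₂)) ≃
      ↥(finsuppAntidiag (univ : Finset (Fin 3)) (3 * D)))
    (Qs Rs : Fin 3 → CX) (t : ℂ) :
    (royMatrix D M₁ M₂ (Qs + t • Rs)).reindex (Equiv.refl _) σ =
      (royMatrix D M₁ M₂ Qs).reindex (Equiv.refl _) σ +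
        t • (royMatrix D M₁ M₂ Rs).reindex (Equiv.refl _) σ := by
  rw [royMatrix_add, royMatrix_smul]
  ext i j
  simp [Matrix.reindex_apply, Matrix.submatrix_apply]

/-- Evaluating the polynomial matrix `A + X B` at `t`. [folklore] -/
theorem eval_det_line {n : Type*} [Fintype n] [DecidableEq n] (A B : Matrix n n ℂ) (t : ℂ) :
    ((A.map Polynomial.C + (Polynomial.X : Polynomial ℂ) • B.map Polynomial.C).det).eval t =
      (A + t • B).det := by
  rw [← Polynomial.coe_evalRingHom, RingHom.map_det, RingHom.mapMatrix_apply]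
  congr 1
  ext i j
  simp [Matrix.map_apply, mul_comm t]

/-- **Roy 2013, Corollary 5.7 (for `Φ`, along lines).** Let `γ = (ξ, η)`, `η ≠ 0`,
`T ≤ binom(3D+2, 2)`, `M₁, M₂` sets of exponents of degree `2D`, `σ` a bijection between columns
and rows. If `Q₀, Q₁, Q₂ ∈ ℂ[X]_D ∩ vanIdeal ξ η T` then for every `R ∈ (ℂ[X])³` the function
`t ↦ Φ(Q + tR)` is a polynomial divisible by `t^T`: `Φ` vanishes to order `≥ T` at `Q` along
every line. [cite: Roy2013, Corollary 5.7] -/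
theorem royPhi_line_multiplicity {ξ η : ℂ} (hη : η ≠ 0) {T : ℕ} (hT : T ≤ (3 * D + 2).choose 2)
    (hM₁ : ∀ μ ∈ M₁, μ.degree = 2 * D) (hM₂ : ∀ μ ∈ M₂, μ.degree = 2 * D)
    (σ : (↥(finsuppAntidiag (univ : Finset (Fin 3)) (2 * D)) ⊕ (↥M₁ ⊕ ↥M₂)) ≃
      ↥(finsuppAntidiag (univ : Finset (Fin 3)) (3 * D)))
    {Qs : Fin 3 → CX} (hQh : ∀ i, (Qs i).IsHomogeneous D) (hQv : ∀ i, Qs i ∈ vanIdeal ξ η T)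
    (Rs : Fin 3 → CX) :
    ∃ p : Polynomial ℂ, (Polynomial.X : Polynomial ℂ) ^ T ∣ p ∧
      ∀ t : ℂ, royPhi D M₁ M₂ σ (Qs + t • Rs) = p.eval t := by
  classical
  obtain ⟨N, hN⟩ := exists_rightInverse_dMat (D := D) hη hT
  set A : Matrix _ _ ℂ := (royMatrix D M₁ M₂ Qs).reindex (Equiv.refl _) σ with hA
  set B : Matrix _ _ ℂ := (royMatrix D M₁ M₂ Rs).reindex (Equiv.refl _) σ with hB
  -- the functionals in the reindexed coordinates
  have hLA : dMat ξ η D T * A = 0 := by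
    rw [hA]
    ext k j
    rw [Matrix.mul_apply, Matrix.zero_apply]
    have h := congr_fun (congr_fun (dMat_mul_royMatrix (T := T) hM₁ hM₂ hQh hQv) k) (σ.symm j)
    rw [Matrix.mul_apply, Matrix.zero_apply] at h
    rw [← h]
    exact Finset.sum_congr rfl fun e _ => by simp [Matrix.reindex_apply, Matrix.submatrix_apply]
  have hdvd := X_pow_card_dvd_det_line (dMat ξ η D T) N hN A B hLA
  rw [Fintype.card_fin] at hdvd
  refine ⟨_, hdvd, fun t => ?_⟩
  rw [royPhi, reindex_royMatrix_line, eval_det_line]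

end Roy2013

end Literature.NumberTheory.Transcendental
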